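import Mathlib
import Literature.Computability.Complexity.RossmanMonotoneClique
import Summits.PneNP.PneNP.Theses.OneSlice

/-!
# Sketch — crux-ideate `stmt-PneNP-2833` (`SingleThreshold`), round 1, ideator 3

Idea `random-host-core-trace`: keep the critical host `H ∼ G(n,p)` RANDOM at every gate
(never restrict, never sprinkle); planted PROPER sub-patterns of `K_k` are invisible to every
`H`-independent monotone test (second moment), so Rossman's Lemma 15 branch is empty at one
threshold; the `H`-relative minterm calculus on the UNRESTRICTED circuit then gives the
AND-assembly / core-trace inequality.  Statements only (no proofs); every constant used is an
existing declaration (`gnpProb`, `gnpWeight`, `Circuit`, `monotoneBasis`, …) or defined here.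
-/

noncomputable section

open Finset Filter Classical

namespace Summit.PneNP.PneNP.Cruxes.SingleThreshold.RandomHostCoreTrace

open Literature.Computability.Complexity

/-- Edge vectors of `K_n` (the input type of the route's circuits). -/
abbrev EV (n : ℕ) : Type := ((⊤ : SimpleGraph (Fin n)).edgeSet) → Bool

/-- The critical density `p = n^{-2/(k-1)}` of the crux. -/
def pCrit (n k : ℕ) : ℝ := (n : ℝ) ^ (-(2 : ℝ) / ((k : ℝ) - 1))

/-- `E(K_k)`: the off-diagonal unordered pairs of `[k]` (labelled patterns are its subsets). -/
def pairsK (k : ℕ) : Finset (Sym2 (Fin k)) := univ.filter fun e => ¬ e.IsDiag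

/-- Placement `Q_ι` of a labelled pattern `Q ⊆ E(K_k)` along an injection `ι : [k] ↪ [n]`,
as an edge vector of `K_n`. For `Q = pairsK k` this is the clique vector of `range ι`. -/
def patVec {n : ℕ} (k : ℕ) (ι : Fin k ↪ Fin n) (Q : Finset (Sym2 (Fin k))) : EV n :=
  fun e => decide ((e : Sym2 (Fin n)) ∈ Q.image (Sym2.map ι))

/-- Planting the pattern: `x ∪ Q_ι`. -/
def plantPat {n : ℕ} (k : ℕ) (ι : Fin k ↪ Fin n) (Q : Finset (Sym2 (Fin k))) (x : EV n) : EV n :=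
  x ⊔ patVec k ι Q

/-- `Pr_{H ∼ G(n,p), ι uniform injection [k] ↪ [n]}[E(H, ι)]` as a finite sum
(`gnpProb` of `RossmanMonotoneClique.lean`; the uniform injection is the uniform labelled
`k`-set, i.e. the uniform `k`-set `A = range ι` with a uniform labelling). -/
def hostEmbProb (n k : ℕ) (p : ℝ) (E : EV n → (Fin k ↪ Fin n) → Prop) : ℝ :=
  (Fintype.card (Fin k ↪ Fin n) : ℝ)⁻¹ *
    ∑ ι : Fin k ↪ Fin n, gnpProb n p (univ.filter fun x => E x ι)

/-- New-acceptance probability of `f` under planting the labelled pattern `Q` at a uniformly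
random place into the random host: `Pr_{H,ι}[f(H) = 0 ∧ f(H ∪ Q_ι) = 1]`. -/
def newAcc (n k : ℕ) (p : ℝ) (Q : Finset (Sym2 (Fin k))) (f : EV n → Bool) : ℝ :=
  hostEmbProb n k p fun x ι => f x = false ∧ f (plantPat k ι Q x) = true

/-- Single-threshold clique ADVANTAGE of a monotone test `f`:
`adv f = Pr[f(H ∪ K_A) = 1] - Pr[f(H) = 1]` = new acceptance of the full clique. -/
def adv (n k : ℕ) (p : ℝ) (f : EV n → Bool) : ℝ := newAcc n k p (pairsK k) f

/-- `y` is an `H`-RELATIVE MINTERM of `f`: `y` is disjoint from `H`, `f(H ∪ y) = 1`, and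
`f(H ∪ y') = 0` for every `y' < y` (minterms of the restriction `y ↦ f(H ∪ y)`; for `H = ⊥`
these are Rossman's minterms). -/
def IsRelMinterm {n : ℕ} (f : EV n → Bool) (H y : EV n) : Prop :=
  y ⊓ H = ⊥ ∧ f (H ⊔ y) = true ∧ ∀ y' < y, f (H ⊔ y') = false

/-- `ρ(f) = Pr_{H,ι}[the planted clique's edge set K_ι is itself an H-relative minterm of f]`
("`f` accepts `H ∪ K_A` and rejects `H ∪ (K_A - e)` for every clique edge `e`"). -/
def rho (n k : ℕ) (p : ℝ) (f : EV n → Bool) : ℝ :=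
  hostEmbProb n k p fun H ι => IsRelMinterm f H (patVec k ι (pairsK k))

/-- The CORE of `f` at `(H, K)`: the meet of all `H`-relative minterms of `f` below `K`
(`= ⊤` if there is none). Pure counting gates have core `⊥` (Transparency below). -/
def core {n : ℕ} (f : EV n → Bool) (H K : EV n) : EV n :=
  (univ.filter fun y => y ≤ K ∧ IsRelMinterm f H y).inf id

/-! ### First lemmas (statements) -/

/-- **Invisibility of planted proper sub-patterns** (second moment / size-biased law,
Rossman 2010 Lemma 17–23 mechanism, CliqueThresholdBounds-style overlap sums): for every
fixed `k ≥ 3` and every PROPER labelled pattern `Q ⊊ E(K_k)` there is `c` such that for all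
large `n` and EVERY monotone `f` on the edges of `K_n` (no size bound),
`Pr_{H,ι}[f(H)=0 ∧ f(H ∪ Q_ι)=1] ≤ c · n^{-1/(k-1)}` at `p = n^{-2/(k-1)}`
(sharp for `Q = K_k` minus one edge; the bound is `½·sd(N_Q)/E N_Q`, `N_Q` = number of
placements of `Q` present in `H`). -/
def Invisibility : Prop :=
  ∀ k : ℕ, 3 ≤ k → ∀ Q : Finset (Sym2 (Fin k)), Q ⊂ pairsK k → ∃ c : ℝ,
    ∀ᶠ n : ℕ in atTop, ∀ f : EV n → Bool, Monotone f →
      newAcc n k (pCrit n k) Q f ≤ c * (n : ℝ) ^ (-(1 : ℝ) / ((k : ℝ) - 1))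

/-- **The relative minterm is the whole clique**: `adv(f) ≤ ρ(f) + Σ_{proper Q} newAcc_Q(f)
+ Pr[K_ι ∩ H ≠ ∅]`, for every monotone `f`, every `n, k, p ∈ [0,1]` (pure combinatorics: on
`{f(H)=0, f(H ∪ K)=1, K ∩ H = ∅}` some `Q_ι ⊆ K_ι` is a relative minterm; if it is proper,
`f` newly accepts the proper pattern `Q`). With `Invisibility` the two error terms are
`O_k(n^{-1/(k-1)})`. -/
def WholeCliqueMinterm : Prop :=
  ∀ (n k : ℕ) (p : ℝ), 3 ≤ k → 0 ≤ p → p ≤ 1 → ∀ f : EV n → Bool, Monotone f →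
    adv n k p f ≤ rho n k p f
      + ∑ Q ∈ (pairsK k).powerset.filter (fun Q => Q ≠ pairsK k), newAcc n k p Q f
      + hostEmbProb n k p (fun H ι => patVec k ι (pairsK k) ⊓ H ≠ ⊥)

/-- **AND-assembly step** (the gate-level core-trace inequality): for monotone `u, v`,
`ρ(u ∧ v) ≤ ρ(u) + ρ(v) + C(k,2) · min(adv u, adv v)`; and `ρ(u ∨ v) ≤ ρ(u) + ρ(v)`.
Proof sketch: if `K` is a relative minterm of `u ∧ v` but of neither child, then for all
relative minterms `y₁ ≤ K` of `u` and `y₂ ≤ K` of `v` one has `y₁ ∪ y₂ = K`, so the two CORES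
are non-empty, proper and cover `K`; a non-empty core `∋ e` forces `u(H ∪ (K-e)) = 0 <
u(H ∪ K) = 1`, an event of probability `≤ adv(u)` for each of the `C(k,2)` edges `e`. -/
def AndAssemblyStep : Prop :=
  ∀ (n k : ℕ) (p : ℝ), 3 ≤ k → 0 ≤ p → p ≤ 1 → ∀ u v : EV n → Bool, Monotone u → Monotone v →
    rho n k p (u ⊓ v) ≤ rho n k p u + rho n k p v
        + (k.choose 2 : ℝ) * min (adv n k p u) (adv n k p v) ∧
    rho n k p (u ⊔ v) ≤ rho n k p u + rho n k p v

/-- **Transparency of symmetric counting** (why pure counters never stop the trace): if the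
restriction `y ↦ g(H ∪ y)` on `↓K` depends only on the NUMBER of on-edges of `y` (a counting
gate as seen from inside the planted clique), then the core of `g` at `(H,K)` is `⊥`, `K ∖ H`
(all of `K` when `K ∩ H = ∅`, the typical case), or `⊤` — never a non-empty proper part. -/
def CountingTransparency : Prop :=
  ∀ (n : ℕ) (g : EV n → Bool) (H K : EV n), Monotone g →
    (∀ y y' : EV n, y ≤ K → y' ≤ K → y ⊓ H = ⊥ → y' ⊓ H = ⊥ →
        (univ.filter fun e => y e = true).card = (univ.filter fun e => y' e = true).card →
        g (H ⊔ y) = g (H ⊔ y')) →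
    core g H K = ⊥ ∨ core g H K = K ⊓ Hᶜ ∨ core g H K = ⊤

/-- **Core trace, circuit level** (event-level union over AND gates, NO path multiplicities,
NO per-gate total-variation loss): for every monotone `{∧₂,∨₂}`-circuit `C` there are at most
`|C|` pairs `(uᵢ, vᵢ)` of functions, each computed by a monotone circuit of size `≤ |C|`
(the children of the AND gates), with `ρ(C) ≤ C(k,2) · Σᵢ min(adv uᵢ, adv vᵢ)`. -/
def CoreTrace : Prop :=
  ∀ (n k : ℕ) (p : ℝ), 3 ≤ k → 0 ≤ p → p ≤ 1 →
    ∀ C : Circuit ((⊤ : SimpleGraph (Fin n)).edgeSet), C.IsOver monotoneBasis →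
      ∃ (s : ℕ) (u v : Fin s → (EV n → Bool)), s ≤ C.size ∧
        (∀ i, Monotone (u i) ∧ Monotone (v i) ∧
          (∃ D : Circuit ((⊤ : SimpleGraph (Fin n)).edgeSet),
              D.IsOver monotoneBasis ∧ D.Computes (u i) ∧ D.size ≤ C.size) ∧
          (∃ D : Circuit ((⊤ : SimpleGraph (Fin n)).edgeSet),
              D.IsOver monotoneBasis ∧ D.Computes (v i) ∧ D.size ≤ C.size)) ∧
        rho n k p C.eval ≤ (k.choose 2 : ℝ) * ∑ i, min (adv n k p (u i)) (adv n k p (v i))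

/-- Probability that `g` has a LARGE PROPER core at the planted clique: `g(H ∪ K)=1`, the core
is a proper non-empty part of `K` carrying at least half of the `C(k,2)` clique edges. This is
the only way an AND gate can STOP the trace (one of the two complementary cores has ≥ half). -/
def largeProperCoreProb (n k : ℕ) (p : ℝ) (g : EV n → Bool) : ℝ :=
  hostEmbProb n k p fun H ι =>
    g (H ⊔ patVec k ι (pairsK k)) = true ∧
    core g H (patVec k ι (pairsK k)) < patVec k ι (pairsK k) ∧
    ⊥ < core g H (patVec k ι (pairsK k)) ∧
    k.choose 2 ≤ 2 * (univ.filter fun e => core g H (patVec k ι (pairsK k)) e = true).card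

/-- **The residual crux of this line (`C⁺`)** — `LargeProperCoreBound`: a monotone circuit of
size `≤ n^c` cannot, with probability `≫ n^{-c}`, INSIST on a specific proper half of a
randomly planted critical clique ("small circuits are not oriented near-clique detectors").
Known to FAIL for arbitrary monotone FUNCTIONS (the orientation-weighted near-clique counter
reaches `n^{-1/(k-1)}`), so any proof must be size-aware; it holds with room for Rossman's
closed functions at the empty host (Lemma 9 + 16: `n^{-k/4-1/8}`). -/
def LargeProperCoreBound : Prop :=
  ∀ c : ℕ, ∃ k : ℕ, 3 ≤ k ∧ ∀ ε : ℝ, 0 < ε → ∀ᶠ n : ℕ in atTop,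
    ∀ D : Circuit ((⊤ : SimpleGraph (Fin n)).edgeSet), D.IsOver monotoneBasis →
      (D.size : ℝ) ≤ (n : ℝ) ^ c →
        largeProperCoreProb n k (pCrit n k) D.eval ≤ ε * (n : ℝ) ^ (-(c : ℝ))

/-- **Core trace with large proper cores, circuit level** (the form used by `Transfer`): the
trace of the relative minterm `K_A` stops at an AND gate only if one of the two children has a
LARGE PROPER core (the two cores are non-empty, proper and cover `K_A`, so one carries at least
half of the clique edges); event-level union over the `≤ |C|` AND gates. -/
def CoreTraceLPC : Prop :=
  ∀ (n k : ℕ) (p : ℝ), 3 ≤ k → 0 ≤ p → p ≤ 1 →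
    ∀ C : Circuit ((⊤ : SimpleGraph (Fin n)).edgeSet), C.IsOver monotoneBasis →
      ∃ (s : ℕ) (u v : Fin s → (EV n → Bool)), s ≤ C.size ∧
        (∀ i, Monotone (u i) ∧ Monotone (v i) ∧
          (∃ D : Circuit ((⊤ : SimpleGraph (Fin n)).edgeSet),
              D.IsOver monotoneBasis ∧ D.Computes (u i) ∧ D.size ≤ C.size) ∧
          (∃ D : Circuit ((⊤ : SimpleGraph (Fin n)).edgeSet),
              D.IsOver monotoneBasis ∧ D.Computes (v i) ∧ D.size ≤ C.size)) ∧
        rho n k p C.eval ≤ ∑ i, (largeProperCoreProb n k p (u i) + largeProperCoreProb n k p (v i))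

/-- **Advantage of a correct circuit** (Lemma 23 / size-bias contiguity at one threshold, the
triage's `√((k!+1)δ)` computation): if `Pr_{G(n,p)}[C ≠ CLIQUE_k] ≤ δ` then
`adv(C) ≥ e^{-1/k!} - δ - √((k!+1)δ) - o(1)`. Stated with an explicit slack `η`. -/
def AdvantageOfCorrect : Prop :=
  ∀ k : ℕ, 3 ≤ k → ∀ δ η : ℝ, 0 < δ → 0 < η →
    η + δ + Real.sqrt ((k.factorial + 1 : ℝ) * δ) < Real.exp (-(1 : ℝ) / k.factorial) →
    ∀ᶠ n : ℕ in atTop, ∀ C : Circuit ((⊤ : SimpleGraph (Fin n)).edgeSet),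
      C.IsOver monotoneBasis →
      gnpProb n (pCrit n k) (univ.filter fun x => C.eval x ≠ cliqueFn n k x) ≤ δ →
        η ≤ adv n k (pCrit n k) C.eval

/-- **Transfer.** The four provable-now statements reduce the crux to `LargeProperCoreBound`:
`ρ(C) ≥ η - o(1)` (AdvantageOfCorrect + WholeCliqueMinterm + Invisibility) while the
event-level core trace bounds `ρ(C)` by `Σ_{∧-gates} (largeProperCoreProb u + largeProperCoreProb v)
≤ 2|C| · ε n^{-c} = 2ε` for `|C| ≤ n^c` — contradiction for `ε < η/2`. (The crux's
error-sum is `gnpProb n p {C ≠ cliqueFn}` by `gnpProb_filter`/`cliqueFn`, as the grounder noted.) -/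
def Transfer : Prop :=
  Invisibility → WholeCliqueMinterm → CoreTraceLPC → AdvantageOfCorrect →
    LargeProperCoreBound → Summit.PneNP.PneNP.Theses.OneSlice.SingleThreshold

end Summit.PneNP.PneNP.Cruxes.SingleThreshold.RandomHostCoreTrace
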